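import Summits.BirchSwinnertonDyer.BirchSwinnertonDyer.Theorems.Rank2ObservatoryListedSpanP
import Summits.BirchSwinnertonDyer.BirchSwinnertonDyer.Theorems.Rank2ObservatoryZModChain
import Summits.BirchSwinnertonDyer.BirchSwinnertonDyer.Theorems.Rank2ObservatoryKernelAnnihilator
import HarnessLib

/-!
# BirchSwinnertonDyer — rank ≥ 2 observatory: the `p`-saturation witness at a good prime

HONEST FRAMING: per-curve certified theorems and census instruments; no claim on BSD in rank ≥ 2.

The kernel side of ONE witness of the next instrument (saturation of the listed generators
`P₁, P₂, P₃ ∈ E(ℚ)` at an odd prime `p`, `Rank2ObservatoryListedSpanP.lean`): for a residue class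
`(a, b, c)` the point `aP₁ + bP₂ + cP₃` is NOT in `p•E(ℚ) = pCoset E(ℚ) p 0` as soon as, at one good
prime `q` with `#Ẽ(𝔽_q) = p · k` (the count is the kernel's `zmodPointCount`), the multiple
`k • (aP̃₁ + bP̃₂ + cP̃₃)` of the REDUCED combination is not `O` — and that multiple is exhibited as
an AFFINE point of `Ẽ(𝔽_q)` by a THREE-GENERATOR ADDITION CHAIN supplied as data (joint
double-and-add over `P̃₁, P̃₂, P̃₃`, every step a `zmodTangent` doubling or a `zmodChord`
addition of one generator; nothing is computed in the kernel beyond the cleared-denominator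
identities):

* `Op`, `chain3B V q g₁ g₂ g₃ cur steps`, `chain3Coeffs`, `chain3Last`, `startPt`, `startCoeffs`
  — the chain, its coefficient bookkeeping `(c₁, c₂, c₃) ↦ 2c` / `c + eᵢ`, its last point, and
  the start register (one of the generators);
* `exists_combo_eq_some_of_chain3B` / `combo_ne_zero_of_chain3B` — soundness: the chain exhibits
  `c₁ • P̃₁ + c₂ • P̃₂ + c₃ • P̃₃` as an affine point, hence `≠ O`;
* `not_mem_pCoset_zero_of_chain3` — the witness on `E(ℚ)`: pull back along the reduction
  homomorphism `reduceMod V q` (`Rank2ObservatoryReductionHom`), `#Ẽ(𝔽_q) • b = 0`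
  (`card_nsmul_eq_zero'` with `natCard_point_eq_zmodPointCount`), and
  `not_mem_pCoset_zero_of_nsmul_ne_zero`.

The residue witnesses `hw` of `listedSpan_saturated_of_not_mem_pCoset` (lane `u = 0`: no
`p`-torsion in the annihilator) are `p³ − 1` instances of this theorem; the row Boolean and the data
files are the next step. Sorry-free; no `decide` executed here.

References: S. Siksek, *Infinite descent on elliptic curves*, Rocky Mountain J. Math. 25 (1995),
§3; J. E. Cremona, *Algorithms for Modular Elliptic Curves* (2nd ed. 1997), §3.5; J. H. Silverman,
*The Arithmetic of Elliptic Curves* (2nd ed. 2009), III.2.3, VII.3.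
-/

-- single-conjunct summit: `Summit.BirchSwinnertonDyer.BirchSwinnertonDyer.…` repeats the name
set_option linter.dupNamespace false

namespace Summit.BirchSwinnertonDyer.BirchSwinnertonDyer.Rank2Observatory

open WeierstrassCurve

/-! ### Three-generator affine addition chains modulo `q` -/

section Chain3

/-- A chain operation: double the current point, or add generator `1`, `2` or `3` to it.
[folklore] -/
inductive Op where
  | dbl : Op
  | add₁ : Op
  | add₂ : Op
  | add₃ : Op

variable (V : WeierstrassCurve ℤ) (q : ℕ)

/-- One step from the current point `cur`, generators `g₁ g₂ g₃`, claimed result `(x, y)`: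
a tangent certificate for `dbl`, a chord certificate for `addᵢ`.
[cite: SilvermanAEC2009, III.2.3] -/
def chain3StepB [NeZero q] (g₁ g₂ g₃ cur : ZMod q × ZMod q) : Op × ZMod q × ZMod q → Bool
  | (.dbl, x, y) => zmodTangent V q cur.1 cur.2 x y
  | (.add₁, x, y) => zmodChord V q cur.1 cur.2 g₁.1 g₁.2 x y
  | (.add₂, x, y) => zmodChord V q cur.1 cur.2 g₂.1 g₂.2 x y
  | (.add₃, x, y) => zmodChord V q cur.1 cur.2 g₃.1 g₃.2 x y

/-- The whole chain checks from `cur`. [cite: SilvermanAEC2009, III.2.3] -/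
def chain3B [NeZero q] (g₁ g₂ g₃ : ZMod q × ZMod q) :
    ZMod q × ZMod q → List (Op × ZMod q × ZMod q) → Bool
  | _, [] => true
  | cur, s :: rest => chain3StepB V q g₁ g₂ g₃ cur s && chain3B g₁ g₂ g₃ s.2 rest

/-- Coefficient bookkeeping: the chain takes `c₁P̃₁ + c₂P̃₂ + c₃P̃₃` to the combination with
coefficients `chain3Coeffs (c₁, c₂, c₃) steps` (`dbl`: `c ↦ c + c`; `addᵢ`: `cᵢ ↦ cᵢ + 1`).
[folklore] -/
def chain3Coeffs {α : Type*} : ℤ × ℤ × ℤ → List (Op × α) → ℤ × ℤ × ℤ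
  | c, [] => c
  | (a, b, c), (.dbl, _) :: rest => chain3Coeffs (a + a, b + b, c + c) rest
  | (a, b, c), (.add₁, _) :: rest => chain3Coeffs (a + 1, b, c) rest
  | (a, b, c), (.add₂, _) :: rest => chain3Coeffs (a, b + 1, c) rest
  | (a, b, c), (.add₃, _) :: rest => chain3Coeffs (a, b, c + 1) rest

/-- The last point of a chain (the start if empty). [folklore] -/
def chain3Last {α : Type*} : α → List (Op × α) → α
  | cur, [] => cur
  | _, s :: rest => chain3Last s.2 rest

/-- The start register: generator `i` for `addᵢ` (and generator `1` for `dbl`). [folklore] -/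
def startPt {α : Type*} (g₁ g₂ g₃ : α) : Op → α
  | .dbl => g₁
  | .add₁ => g₁
  | .add₂ => g₂
  | .add₃ => g₃

/-- The coefficients of the start register. [folklore] -/
def startCoeffs : Op → ℤ × ℤ × ℤ
  | .dbl => (1, 0, 0)
  | .add₁ => (1, 0, 0)
  | .add₂ => (0, 1, 0)
  | .add₃ => (0, 0, 1)

variable [Fact q.Prime]

/-- **Soundness of three-generator chains**: if `c₁P̃₁ + c₂P̃₂ + c₃P̃₃` is the affine point `cur`
and the chain checks from `cur`, then the combination with coefficients `chain3Coeffs c steps` is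
the affine point `chain3Last cur steps` (induction; each step is the tangent / chord certificate
and a `module` identity). [cite: SilvermanAEC2009, III.2.3] -/
theorem exists_combo_eq_some_of_chain3B {x₁ y₁ x₂ y₂ x₃ y₃ : ZMod q}
    (h₁ : (V.map (Int.castRingHom (ZMod q))).toAffine.Nonsingular x₁ y₁)
    (h₂ : (V.map (Int.castRingHom (ZMod q))).toAffine.Nonsingular x₂ y₂)
    (h₃ : (V.map (Int.castRingHom (ZMod q))).toAffine.Nonsingular x₃ y₃) :
    ∀ (steps : List (Op × ZMod q × ZMod q)) (cur : ZMod q × ZMod q) (c : ℤ × ℤ × ℤ)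
      (hcur : (V.map (Int.castRingHom (ZMod q))).toAffine.Nonsingular cur.1 cur.2),
      c.1 • (Affine.Point.some x₁ y₁ h₁ : (V.map (Int.castRingHom (ZMod q))).toAffine.Point)
          + c.2.1 • Affine.Point.some x₂ y₂ h₂ + c.2.2 • Affine.Point.some x₃ y₃ h₃ =
          .some cur.1 cur.2 hcur →
        chain3B V q (x₁, y₁) (x₂, y₂) (x₃, y₃) cur steps = true →
        ∃ h : (V.map (Int.castRingHom (ZMod q))).toAffine.Nonsingular
            (chain3Last cur steps).1 (chain3Last cur steps).2,
          (chain3Coeffs c steps).1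
                • (Affine.Point.some x₁ y₁ h₁ : (V.map (Int.castRingHom (ZMod q))).toAffine.Point)
              + (chain3Coeffs c steps).2.1 • Affine.Point.some x₂ y₂ h₂
              + (chain3Coeffs c steps).2.2 • Affine.Point.some x₃ y₃ h₃ =
            .some (chain3Last cur steps).1 (chain3Last cur steps).2 h := by
  intro steps
  induction steps with
  | nil =>
    intro cur c hcur hn _
    exact ⟨hcur, hn⟩
  | cons s rest ih =>
    intro cur c hcur hn hc
    obtain ⟨o, x, y⟩ := s
    obtain ⟨a, b, c⟩ := c
    have hc' : chain3StepB V q (x₁, y₁) (x₂, y₂) (x₃, y₃) cur (o, x, y) = true ∧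
        chain3B V q (x₁, y₁) (x₂, y₂) (x₃, y₃) (x, y) rest = true := by
      simpa [chain3B, Bool.and_eq_true] using hc
    obtain ⟨hs, hrest⟩ := hc'
    cases o with
    | dbl =>
      obtain ⟨h', hadd⟩ := exists_some_add_self_of_zmodTangent V q hcur hs
      refine ih (x, y) (a + a, b + b, c + c) h' ?_ hrest
      have e : (a + a) •
            (Affine.Point.some x₁ y₁ h₁ : (V.map (Int.castRingHom (ZMod q))).toAffine.Point)
          + (b + b) • Affine.Point.some x₂ y₂ h₂ + (c + c) • Affine.Point.some x₃ y₃ h₃ =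
          (a • Affine.Point.some x₁ y₁ h₁ + b • Affine.Point.some x₂ y₂ h₂
              + c • Affine.Point.some x₃ y₃ h₃)
            + (a • Affine.Point.some x₁ y₁ h₁ + b • Affine.Point.some x₂ y₂ h₂
              + c • Affine.Point.some x₃ y₃ h₃) := by
        module
      rw [e, hn, hadd]
    | add₁ =>
      obtain ⟨h', hadd⟩ := exists_some_add_some_of_zmodChord V q hcur h₁ hs
      refine ih (x, y) (a + 1, b, c) h' ?_ hrest
      have e : (a + 1) •
            (Affine.Point.some x₁ y₁ h₁ : (V.map (Int.castRingHom (ZMod q))).toAffine.Point)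
          + b • Affine.Point.some x₂ y₂ h₂ + c • Affine.Point.some x₃ y₃ h₃ =
          (a • Affine.Point.some x₁ y₁ h₁ + b • Affine.Point.some x₂ y₂ h₂
              + c • Affine.Point.some x₃ y₃ h₃) + Affine.Point.some x₁ y₁ h₁ := by
        module
      rw [e, hn, hadd]
    | add₂ =>
      obtain ⟨h', hadd⟩ := exists_some_add_some_of_zmodChord V q hcur h₂ hs
      refine ih (x, y) (a, b + 1, c) h' ?_ hrest
      have e : a •
            (Affine.Point.some x₁ y₁ h₁ : (V.map (Int.castRingHom (ZMod q))).toAffine.Point)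
          + (b + 1) • Affine.Point.some x₂ y₂ h₂ + c • Affine.Point.some x₃ y₃ h₃ =
          (a • Affine.Point.some x₁ y₁ h₁ + b • Affine.Point.some x₂ y₂ h₂
              + c • Affine.Point.some x₃ y₃ h₃) + Affine.Point.some x₂ y₂ h₂ := by
        module
      rw [e, hn, hadd]
    | add₃ =>
      obtain ⟨h', hadd⟩ := exists_some_add_some_of_zmodChord V q hcur h₃ hs
      refine ih (x, y) (a, b, c + 1) h' ?_ hrest
      have e : a •
            (Affine.Point.some x₁ y₁ h₁ : (V.map (Int.castRingHom (ZMod q))).toAffine.Point)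
          + b • Affine.Point.some x₂ y₂ h₂ + (c + 1) • Affine.Point.some x₃ y₃ h₃ =
          (a • Affine.Point.some x₁ y₁ h₁ + b • Affine.Point.some x₂ y₂ h₂
              + c • Affine.Point.some x₃ y₃ h₃) + Affine.Point.some x₃ y₃ h₃ := by
        module
      rw [e, hn, hadd]

/-- **A checked chain exhibits a combination as an affine point, so it is not `O`.** Started at
generator `s₀` (coefficients `startCoeffs s₀`), the combination with coefficients
`chain3Coeffs (startCoeffs s₀) steps` of `P̃₁, P̃₂, P̃₃` is `≠ O` in `Ẽ(𝔽_q)`.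
[cite: SilvermanAEC2009, III.2.3] -/
theorem combo_ne_zero_of_chain3B {x₁ y₁ x₂ y₂ x₃ y₃ : ZMod q}
    (h₁ : (V.map (Int.castRingHom (ZMod q))).toAffine.Nonsingular x₁ y₁)
    (h₂ : (V.map (Int.castRingHom (ZMod q))).toAffine.Nonsingular x₂ y₂)
    (h₃ : (V.map (Int.castRingHom (ZMod q))).toAffine.Nonsingular x₃ y₃) (s₀ : Op)
    {steps : List (Op × ZMod q × ZMod q)}
    (hc : chain3B V q (x₁, y₁) (x₂, y₂) (x₃, y₃) (startPt (x₁, y₁) (x₂, y₂) (x₃, y₃) s₀) steps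
      = true) :
    (chain3Coeffs (startCoeffs s₀) steps).1
          • (Affine.Point.some x₁ y₁ h₁ : (V.map (Int.castRingHom (ZMod q))).toAffine.Point)
        + (chain3Coeffs (startCoeffs s₀) steps).2.1 • Affine.Point.some x₂ y₂ h₂
        + (chain3Coeffs (startCoeffs s₀) steps).2.2 • Affine.Point.some x₃ y₃ h₃ ≠ 0 := by
  cases s₀ with
  | dbl =>
    obtain ⟨h, e⟩ := exists_combo_eq_some_of_chain3B V q h₁ h₂ h₃ steps (x₁, y₁) (1, 0, 0) h₁
      (by simp only [one_zsmul, zero_zsmul, add_zero]) hc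
    rw [startCoeffs, e]
    exact Affine.Point.some_ne_zero h
  | add₁ =>
    obtain ⟨h, e⟩ := exists_combo_eq_some_of_chain3B V q h₁ h₂ h₃ steps (x₁, y₁) (1, 0, 0) h₁
      (by simp only [one_zsmul, zero_zsmul, add_zero]) hc
    rw [startCoeffs, e]
    exact Affine.Point.some_ne_zero h
  | add₂ =>
    obtain ⟨h, e⟩ := exists_combo_eq_some_of_chain3B V q h₁ h₂ h₃ steps (x₂, y₂) (0, 1, 0) h₂
      (by simp only [one_zsmul, zero_zsmul, add_zero, zero_add]) hc
    rw [startCoeffs, e]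
    exact Affine.Point.some_ne_zero h
  | add₃ =>
    obtain ⟨h, e⟩ := exists_combo_eq_some_of_chain3B V q h₁ h₂ h₃ steps (x₃, y₃) (0, 0, 1) h₃
      (by simp only [one_zsmul, zero_zsmul, add_zero, zero_add]) hc
    rw [startCoeffs, e]
    exact Affine.Point.some_ne_zero h

end Chain3

/-! ### The witness on `E(ℚ)` -/

section Witness

variable (V : WeierstrassCurve ℤ) (q : ℕ) [Fact q.Prime]

/-- **The `p`-saturation witness at a good prime `q`.** Let `q ∤ Δ(V)`, `#Ẽ(𝔽_q) = p · k` (kernel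
count `zmodPointCount`), let the rational points `P₁, P₂, P₃` reduce to the affine points
`P̃ᵢ = (xᵢ, yᵢ)` (`reduceMod_some` for integral points), and let a checked three-generator chain
started at generator `s₀` reach the coefficients `(k a, k b, k c)`. Then
`aP₁ + bP₂ + cP₃ ∉ p•E(ℚ) = pCoset E(ℚ) p 0`: its reduction `R̃ = aP̃₁ + bP̃₂ + cP̃₃` has
`k • R̃ ≠ O` (the chain exhibits it as an affine point), while `k • (p•Ẽ(𝔽_q)) = 0`. Siksek 1995 §3.
[cite: SilvermanAEC2009, VII.3] [cite: CremonaAlgorithms1997, §3.5] -/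
theorem not_mem_pCoset_zero_of_chain3 (hq : ¬ (q : ℤ) ∣ V.Δ) {p k : ℕ}
    (hN : zmodPointCount V q = p * k)
    {P₁ P₂ P₃ : (V.map (Int.castRingHom ℚ)).toAffine.Point} {x₁ y₁ x₂ y₂ x₃ y₃ : ZMod q}
    (h₁ : (V.map (Int.castRingHom (ZMod q))).toAffine.Nonsingular x₁ y₁)
    (h₂ : (V.map (Int.castRingHom (ZMod q))).toAffine.Nonsingular x₂ y₂)
    (h₃ : (V.map (Int.castRingHom (ZMod q))).toAffine.Nonsingular x₃ y₃)
    (hP₁ : reduceMod V q hq P₁ = .some x₁ y₁ h₁) (hP₂ : reduceMod V q hq P₂ = .some x₂ y₂ h₂)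
    (hP₃ : reduceMod V q hq P₃ = .some x₃ y₃ h₃) {a b c : ℤ} (s₀ : Op)
    {steps : List (Op × ZMod q × ZMod q)}
    (hc : chain3B V q (x₁, y₁) (x₂, y₂) (x₃, y₃) (startPt (x₁, y₁) (x₂, y₂) (x₃, y₃) s₀) steps
      = true)
    (hk : chain3Coeffs (startCoeffs s₀) steps = ((k : ℤ) * a, (k : ℤ) * b, (k : ℤ) * c)) :
    a • P₁ + b • P₂ + c • P₃ ∉ pCoset (V.map (Int.castRingHom ℚ)).toAffine.Point p 0 := by
  refine not_mem_pCoset_of_map_not_mem (reduceMod V q hq) ?_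
  rw [map_add, map_add, map_zsmul, map_zsmul, map_zsmul, hP₁, hP₂, hP₃]
  refine not_mem_pCoset_zero_of_nsmul_ne_zero (k := k) (fun y => ?_) ?_
  · rw [← hN, ← natCard_point_eq_zmodPointCount V q hq]
    exact card_nsmul_eq_zero'
  · have e : k •
          (a • (Affine.Point.some x₁ y₁ h₁ : (V.map (Int.castRingHom (ZMod q))).toAffine.Point)
          + b • Affine.Point.some x₂ y₂ h₂ + c • Affine.Point.some x₃ y₃ h₃) =
        ((k : ℤ) * a) • Affine.Point.some x₁ y₁ h₁ + ((k : ℤ) * b) • Affine.Point.some x₂ y₂ h₂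
          + ((k : ℤ) * c) • Affine.Point.some x₃ y₃ h₃ := by
      module
    rw [e]
    have hne := combo_ne_zero_of_chain3B V q h₁ h₂ h₃ s₀ hc
    rwa [hk] at hne

end Witness

end Summit.BirchSwinnertonDyer.BirchSwinnertonDyer.Rank2Observatory
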